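import Mathlib
import HarnessLib
import Summits.HubbardSuperconductivity.HubbardSuperconductivity.Theorems.KLProgrammeKLRegimeEnginePairTransferMemberLines
import Summits.HubbardSuperconductivity.HubbardSuperconductivity.Theorems.KLProgrammeKLRegimeWickScaleFlowX
import Summits.HubbardSuperconductivity.HubbardSuperconductivity.Theorems.KLProgrammeKLRegimeSplitEdgeFactsRunningWeight

/-!
# Route `KLProgramme` — ENGINE child gen 8 (stmt-HubbardSuperconductivity-20437 `KLRegimeEngineV17F2`), skeleton v2 class #5 rev 3 / (E2-F2): the MEMBER flow in Riccati form
# with EXPLICIT RESOLVED RUNGS — `klmc_hasDerivAt_runningPair_path`, `klmc_continuousOn_runningPair_deriv_path`, `klmc_rungRate_eq`, **`klmc_flow_source_eq`**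
# (cell gate-hubbard-kl, seat hubbard-kl-k3c1-p1 g11, technique «composed-map remainder propagation»; member twin of `klws_flow_source_eq`, p515641)

WHY.  `klws_flow_source_eq` (`…WickScaleFlowX`) identifies, for the WICK member (`D = C^K_{≤Λ}`), the source `Γ̇ + Γ·diag ḃ·Γ` of the resolved pair kernel along the affine
path with the non-ladder classes of the bilinear Wick flow, for the explicit soft-pair rungs `b(z) = −(βL²)⁻¹ĝ_K(p)ĝ_K(p̄)·(1 − w_Λ(p))(1 − w_Λ(p̄))`.  A general MEMBER `ψ` of
class #5 (and the history member of (E2-F2)) is Wick-ordered w.r.t. `softCovOf K φ_Λ`, `φ_Λ = ψ + (w_{Λ₁} − w_Λ)` (p1's running symbol), so its resolved rung is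
`b(z) = −(βL²)⁻¹ĝ_K(p)ĝ_K(p̄)·φ_Λ(p)·φ_Λ(p̄)` (p1's `klBubbleMass(φ_Λ, φ_Λ)` is its frequency aggregate) with rate `ḃ(z) = c(z)·(Λ₁−Λ₀)·(−ẇ(p)φ(p̄) − φ(p)ẇ(p̄))`.  This file is
the member twin: the rung's calculus along the path (`klmc_hasDerivAt_runningPair_path`, `klmc_continuousOn_runningPair_deriv_path`), the coefficient identity
(`klmc_rungRate_eq`), and **`klmc_flow_source_eq`** — `Γ̇ + Γ·diag ḃ·Γ = (Λ₁ − Λ₀)·[−½𝒱₄(dblFold(Δ_×Ċ((e^{Δ_×D} − Δ_×D)(𝓜⁰𝓜¹))))(Z) − (βL²)⁻³(PHd − PHx − 2·S62)]` for the member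
carrier `𝓜 = e^{Δ_D}𝒢^K_Λ` (over `klmc_member_source_split`, p596011) — the RESOLVED Riccati defect of a member BY NAME; its frequency aggregation / pinning to the `ω₀` arrays
of `klmf_memberArray_flowData` is the localisation step of KLTC v3/v4.
Exact algebra + calculus over landed lemmas; nothing about the model's sizes is asserted; nothing asserts superconductivity.  0 kit.
-/

noncomputable section

namespace Summit.HubbardSuperconductivity.HubbardSuperconductivity.Theorems.KLRegimeWick

set_option linter.dupNamespace false -- summit = problem name (single-conjunct summit), D-0017

open Set Literature.MathematicalPhysics.QuantumLattice GrassmannAlgebra Finset Matrix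
open Literature.Probability.LatticeModels
open Summit.HubbardSuperconductivity.HubbardSuperconductivity.Theorems.TwoPointAssembly
open Summit.HubbardSuperconductivity.HubbardSuperconductivity.Theorems.KLProgrammeLegKernels
open Summit.HubbardSuperconductivity.HubbardSuperconductivity.Theorems.KLRegimeSplit

section Rungs

variable (L M : ℕ) (β μ : ℝ) (K : TrigPolyC4v)

/-- **Derivative of the member's running pair weight along the path**: with `φ_s(q) = ψ(q) + (w_{Λ₁}(q) − w_{Λ(s)}(q))`,
`∂_t[φ_t(k)·φ_t(k′)] = (Λ₁ − Λ₀)·(−ẇ_{Λ(t)}(k)·φ_t(k′) − φ_t(k)·ẇ_{Λ(t)}(k′))`. -/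
theorem klmc_hasDerivAt_runningPair_path {Λ₀ Λ₁ : ℝ} (h10 : Λ₁ ≤ Λ₀) (h1 : 0 < Λ₁) (ψ : FreqMomentum L M → ℝ) {t : ℝ} (ht : t ∈ Icc (0 : ℝ) 1)
    (k k' : FreqMomentum L M) :
    HasDerivAt (fun s : ℝ => (ψ k + (hubbardCutoffWeightCT L M β μ K Λ₁ k - hubbardCutoffWeightCT L M β μ K (Λ₀ + s * (Λ₁ - Λ₀)) k)) * (ψ k' + (hubbardCutoffWeightCT L M β μ K Λ₁ k' - hubbardCutoffWeightCT L M β μ K (Λ₀ + s * (Λ₁ - Λ₀)) k')))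
      ((Λ₁ - Λ₀) * (-deriv (fun Λ' : ℝ => hubbardCutoffWeightCT L M β μ K Λ' k) (Λ₀ + t * (Λ₁ - Λ₀)) * (ψ k' + (hubbardCutoffWeightCT L M β μ K Λ₁ k' - hubbardCutoffWeightCT L M β μ K (Λ₀ + t * (Λ₁ - Λ₀)) k')) -
        (ψ k + (hubbardCutoffWeightCT L M β μ K Λ₁ k - hubbardCutoffWeightCT L M β μ K (Λ₀ + t * (Λ₁ - Λ₀)) k)) * deriv (fun Λ' : ℝ => hubbardCutoffWeightCT L M β μ K Λ' k') (Λ₀ + t * (Λ₁ - Λ₀)))) t := by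
  have hne : Λ₀ + t * (Λ₁ - Λ₀) ≠ 0 := (h1.trans_le (klws_affine_mem_Icc h10 ht).1).ne'
  have hw : ∀ q : FreqMomentum L M, HasDerivAt (fun s : ℝ => hubbardCutoffWeightCT L M β μ K (Λ₀ + s * (Λ₁ - Λ₀)) q)
      ((Λ₁ - Λ₀) * deriv (fun Λ' : ℝ => hubbardCutoffWeightCT L M β μ K Λ' q) (Λ₀ + t * (Λ₁ - Λ₀))) t := by
    intro q
    have hg := (klws_hasDerivAt_cutoffWeight_scale L M β μ K hne q)
    have hd : HasDerivAt (fun Λ' : ℝ => hubbardCutoffWeightCT L M β μ K Λ' q)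
        (deriv (fun Λ' : ℝ => hubbardCutoffWeightCT L M β μ K Λ' q) (Λ₀ + t * (Λ₁ - Λ₀))) (Λ₀ + t * (Λ₁ - Λ₀)) :=
      hg.differentiableAt.hasDerivAt
    have hc := hd.scomp t (klws_hasDerivAt_affine Λ₀ Λ₁ t)
    simpa only [Function.comp_def, smul_eq_mul] using hc
  have hu : ∀ q : FreqMomentum L M, HasDerivAt (fun s : ℝ => ψ q + (hubbardCutoffWeightCT L M β μ K Λ₁ q - hubbardCutoffWeightCT L M β μ K (Λ₀ + s * (Λ₁ - Λ₀)) q))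
      (-((Λ₁ - Λ₀) * deriv (fun Λ' : ℝ => hubbardCutoffWeightCT L M β μ K Λ' q) (Λ₀ + t * (Λ₁ - Λ₀)))) t := by
    intro q
    simpa using ((hw q).const_sub (hubbardCutoffWeightCT L M β μ K Λ₁ q)).const_add (ψ q)
  refine ((hu k).mul (hu k')).congr_deriv ?_
  ring

/-- **Continuity of the member's rung derivative along the path.** -/
theorem klmc_continuousOn_runningPair_deriv_path {Λ₀ Λ₁ : ℝ} (h10 : Λ₁ ≤ Λ₀) (h1 : 0 < Λ₁) (ψ : FreqMomentum L M → ℝ) (k k' : FreqMomentum L M) :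
    ContinuousOn (fun t : ℝ => (Λ₁ - Λ₀) * (-deriv (fun Λ' : ℝ => hubbardCutoffWeightCT L M β μ K Λ' k) (Λ₀ + t * (Λ₁ - Λ₀)) * (ψ k' + (hubbardCutoffWeightCT L M β μ K Λ₁ k' - hubbardCutoffWeightCT L M β μ K (Λ₀ + t * (Λ₁ - Λ₀)) k')) -
        (ψ k + (hubbardCutoffWeightCT L M β μ K Λ₁ k - hubbardCutoffWeightCT L M β μ K (Λ₀ + t * (Λ₁ - Λ₀)) k)) * deriv (fun Λ' : ℝ => hubbardCutoffWeightCT L M β μ K Λ' k') (Λ₀ + t * (Λ₁ - Λ₀)))) (Icc 0 1) := by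
  intro t ht
  have hne : Λ₀ + t * (Λ₁ - Λ₀) ≠ 0 := (h1.trans_le (klws_affine_mem_Icc h10 ht).1).ne'
  have hp : ContinuousAt (fun s : ℝ => Λ₀ + s * (Λ₁ - Λ₀)) t := (klws_hasDerivAt_affine Λ₀ Λ₁ t).continuousAt
  have hdw : ∀ q : FreqMomentum L M, ContinuousAt
      (fun s : ℝ => deriv (fun Λ' : ℝ => hubbardCutoffWeightCT L M β μ K Λ' q) (Λ₀ + s * (Λ₁ - Λ₀))) t := fun q =>
    ContinuousAt.comp (f := fun s : ℝ => Λ₀ + s * (Λ₁ - Λ₀)) (x := t) (klws_continuousAt_derivCutoffWeight_scale L M β μ K hne q) hp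
  have hcw : ∀ q : FreqMomentum L M, ContinuousAt
      (fun s : ℝ => ψ q + (hubbardCutoffWeightCT L M β μ K Λ₁ q - hubbardCutoffWeightCT L M β μ K (Λ₀ + s * (Λ₁ - Λ₀)) q)) t := fun q =>
    continuousAt_const.add (continuousAt_const.sub
      (ContinuousAt.comp (f := fun s : ℝ => Λ₀ + s * (Λ₁ - Λ₀)) (x := t) (klws_continuousAt_cutoffWeight_scale L M β μ K hne q) hp))
  exact (continuousAt_const.mul (((hdw k).neg.mul (hcw k')).sub ((hcw k).mul (hdw k')))).continuousWithinAt

variable [NeZero L]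

/-- The member rung coefficient identity (general weights `a₁, a₂`): `c·(d(−d₁a₂ − a₁d₂)) = d·(βL²)⁻³·((a₁βL²g)(d₂βL²g′) + (d₁βL²g)(a₂βL²g′))`, `c = −(βL²)⁻¹gg′`. -/
theorem klmc_rungRate_eq (hβ : β ≠ 0) (d : ℝ) (g g' : ℂ) (a₁ a₂ d₁ d₂ : ℝ) :
    -((((β * (L : ℝ) ^ 2 : ℝ) : ℂ))⁻¹ * g * g') * (((d * (-d₁ * a₂ - a₁ * d₂) : ℝ) : ℂ)) =
      ((d : ℝ) : ℂ) * (((((β * (L : ℝ) ^ 2 : ℝ) : ℂ)) ^ 3)⁻¹ *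
        ((((a₁ : ℝ) : ℂ) * (((β * (L : ℝ) ^ 2 : ℝ) : ℂ) * g)) * (((d₂ : ℝ) : ℂ) * (((β * (L : ℝ) ^ 2 : ℝ) : ℂ) * g')) +
          (((d₁ : ℝ) : ℂ) * (((β * (L : ℝ) ^ 2 : ℝ) : ℂ) * g)) * ((((a₂ : ℝ) : ℂ) * (((β * (L : ℝ) ^ 2 : ℝ) : ℂ) * g'))))) := by
  have hL : (L : ℝ) ≠ 0 := Nat.cast_ne_zero.2 (NeZero.ne L)
  have hb : (((β * (L : ℝ) ^ 2 : ℝ) : ℂ)) ≠ 0 := by exact_mod_cast mul_ne_zero hβ (pow_ne_zero 2 hL)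
  field_simp
  push_cast
  ring

end Rungs

section Model

variable (L M : ℕ) [NeZero L] [NeZero M] (β U μ : ℝ) (K : TrigPolyC4v)

/-- **The member's within-slice flow in Riccati form with explicit resolved rungs** (member twin of `klws_flow_source_eq`; see the module docstring). -/
theorem klmc_flow_source_eq (hβ : β ≠ 0) {Λ₀ Λ₁ : ℝ} (h10 : Λ₁ ≤ Λ₀) (h1 : 0 < Λ₁) (ψ : FreqMomentum L M → ℝ) (Q : TorusSite 2 L)
    (Γ Γ' : ℝ → Matrix (TorusSite 2 L × MatsubaraIdx M) (TorusSite 2 L × MatsubaraIdx M) ℂ)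
    (b b' : ℝ → TorusSite 2 L × MatsubaraIdx M → ℂ)
    (hΓdef : Γ = fun t => Matrix.of fun x y => vertexFn L M β
      (gaussConv ℂ (softCovOf L M β μ K ψ + hubbardCovAboveCT L M β μ 0 K Λ₁ - hubbardCovAboveCT L M β μ 0 K (Λ₀ + t * (Λ₁ - Λ₀)))
        (hubbardEffectiveActionCT L M β U μ 0 K (Λ₀ + t * (Λ₁ - Λ₀)))) 4
      ![(((y.2, y.1), 0), 0), (((y.2.rev, Q - y.1), 1), 0), (((x.2.rev, Q - x.1), 1), 1), (((x.2, x.1), 0), 1)])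
    (hΓ'def : Γ' = fun t => Matrix.of fun x y => (Λ₁ - Λ₀) • -((2 : ℂ)⁻¹ * vertexFn L M β
      (gaussConv ℂ (softCovOf L M β μ K ψ + hubbardCovAboveCT L M β μ 0 K Λ₁ - hubbardCovAboveCT L M β μ 0 K (Λ₀ + t * (Λ₁ - Λ₀)))
        (grassmannDerivPairing ℂ
          (Matrix.of fun X Y : HubbardFieldIdx L M =>
            deriv (fun Λ'' : ℝ => hubbardCovAboveCT L M β μ 0 K Λ'' X Y) (Λ₀ + t * (Λ₁ - Λ₀)))
          (hubbardEffectiveActionCT L M β U μ 0 K (Λ₀ + t * (Λ₁ - Λ₀)))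
          (hubbardEffectiveActionCT L M β U μ 0 K (Λ₀ + t * (Λ₁ - Λ₀))))) 4
      ![(((y.2, y.1), 0), 0), (((y.2.rev, Q - y.1), 1), 0), (((x.2.rev, Q - x.1), 1), 1), (((x.2, x.1), 0), 1)]))
    (hbdef : b = fun t z => -((((β * (L : ℝ) ^ 2 : ℝ) : ℂ))⁻¹ * propCT L M β μ K (z.2, z.1) * propCT L M β μ K (z.2.rev, Q - z.1)) *
      ((((ψ (z.2, z.1) + (hubbardCutoffWeightCT L M β μ K Λ₁ (z.2, z.1) - hubbardCutoffWeightCT L M β μ K (Λ₀ + t * (Λ₁ - Λ₀)) (z.2, z.1))) *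
        (ψ (z.2.rev, Q - z.1) + (hubbardCutoffWeightCT L M β μ K Λ₁ (z.2.rev, Q - z.1) - hubbardCutoffWeightCT L M β μ K (Λ₀ + t * (Λ₁ - Λ₀)) (z.2.rev, Q - z.1))) : ℝ) : ℂ)))
    (hb'def : b' = fun t z => -((((β * (L : ℝ) ^ 2 : ℝ) : ℂ))⁻¹ * propCT L M β μ K (z.2, z.1) * propCT L M β μ K (z.2.rev, Q - z.1)) *
      ((((Λ₁ - Λ₀) * (-deriv (fun Λ' : ℝ => hubbardCutoffWeightCT L M β μ K Λ' (z.2, z.1)) (Λ₀ + t * (Λ₁ - Λ₀)) *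
          (ψ (z.2.rev, Q - z.1) + (hubbardCutoffWeightCT L M β μ K Λ₁ (z.2.rev, Q - z.1) - hubbardCutoffWeightCT L M β μ K (Λ₀ + t * (Λ₁ - Λ₀)) (z.2.rev, Q - z.1))) -
        (ψ (z.2, z.1) + (hubbardCutoffWeightCT L M β μ K Λ₁ (z.2, z.1) - hubbardCutoffWeightCT L M β μ K (Λ₀ + t * (Λ₁ - Λ₀)) (z.2, z.1))) *
          deriv (fun Λ' : ℝ => hubbardCutoffWeightCT L M β μ K Λ' (z.2.rev, Q - z.1)) (Λ₀ + t * (Λ₁ - Λ₀))) : ℝ) : ℂ))) :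
    (∀ t ∈ Icc (0 : ℝ) 1, ∀ z, HasDerivAt (fun s => b s z) (b' t z) t) ∧
    (∀ z, ContinuousOn (fun t => b' t z) (Icc 0 1)) ∧
    ∀ t ∈ Icc (0 : ℝ) 1, ∀ x y : TorusSite 2 L × MatsubaraIdx M,
      (Γ' t + Γ t * diagonal (b' t) * Γ t) x y =
        ((Λ₁ - Λ₀ : ℝ) : ℂ) *
          (-((2 : ℂ)⁻¹ * vertexFn L M β (dblFold ℂ (grassmannLaplacian ℂ
              (crossCov ℂ (Matrix.of fun X Y : HubbardFieldIdx L M =>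
                deriv (fun Λ' : ℝ => hubbardCovAboveCT L M β μ 0 K Λ' X Y) (Λ₀ + t * (Λ₁ - Λ₀))))
              ((gaussConv ℂ (crossCov ℂ (softCovOf L M β μ K ψ + hubbardCovAboveCT L M β μ 0 K Λ₁ - hubbardCovAboveCT L M β μ 0 K (Λ₀ + t * (Λ₁ - Λ₀)))) -
                  grassmannLaplacian ℂ (crossCov ℂ (softCovOf L M β μ K ψ + hubbardCovAboveCT L M β μ 0 K Λ₁ - hubbardCovAboveCT L M β μ 0 K (Λ₀ + t * (Λ₁ - Λ₀)))))
                (dblCopy ℂ 0 (gaussConv ℂ (softCovOf L M β μ K ψ + hubbardCovAboveCT L M β μ 0 K Λ₁ - hubbardCovAboveCT L M β μ 0 K (Λ₀ + t * (Λ₁ - Λ₀)))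
                    (hubbardEffectiveActionCT L M β U μ 0 K (Λ₀ + t * (Λ₁ - Λ₀)))) *
                  dblCopy ℂ 1 (gaussConv ℂ (softCovOf L M β μ K ψ + hubbardCovAboveCT L M β μ 0 K Λ₁ - hubbardCovAboveCT L M β μ 0 K (Λ₀ + t * (Λ₁ - Λ₀)))
                    (hubbardEffectiveActionCT L M β U μ 0 K (Λ₀ + t * (Λ₁ - Λ₀)))))))) 4
              ![(((y.2, y.1), 0), 0), (((y.2.rev, Q - y.1), 1), 0), (((x.2.rev, Q - x.1), 1), 1), (((x.2, x.1), 0), 1)]) -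
            ((((β * (L : ℝ) ^ 2 : ℝ) : ℂ)) ^ 3)⁻¹ *
              ((∑ p : FreqMomentum L M, ∑ σ : Fin 2, ∑ p' : FreqMomentum L M,
                  if matsubaraInt M p'.1 + matsubaraInt M y.2 = matsubaraInt M p.1 + matsubaraInt M x.2 ∧ p'.2 = p.2 + x.1 - y.1 then
                    ((((ψ p + (hubbardCutoffWeightCT L M β μ K Λ₁ p - hubbardCutoffWeightCT L M β μ K (Λ₀ + t * (Λ₁ - Λ₀)) p) : ℝ) : ℂ) *
                          (((β * (L : ℝ) ^ 2 : ℝ) : ℂ) * propCT L M β μ K p)) *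
                        (((deriv (fun Λ' : ℝ => hubbardCutoffWeightCT L M β μ K Λ' p') (Λ₀ + t * (Λ₁ - Λ₀)) : ℝ) : ℂ) *
                          (((β * (L : ℝ) ^ 2 : ℝ) : ℂ) * propCT L M β μ K p')) +
                      (((deriv (fun Λ' : ℝ => hubbardCutoffWeightCT L M β μ K Λ' p) (Λ₀ + t * (Λ₁ - Λ₀)) : ℝ) : ℂ) *
                          (((β * (L : ℝ) ^ 2 : ℝ) : ℂ) * propCT L M β μ K p)) *
                        ((((ψ p' + (hubbardCutoffWeightCT L M β μ K Λ₁ p' - hubbardCutoffWeightCT L M β μ K (Λ₀ + t * (Λ₁ - Λ₀)) p') : ℝ) : ℂ) *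
                          (((β * (L : ℝ) ^ 2 : ℝ) : ℂ) * propCT L M β μ K p')))) *
                      (vertexFn L M β (gaussConv ℂ (softCovOf L M β μ K ψ + hubbardCovAboveCT L M β μ 0 K Λ₁ - hubbardCovAboveCT L M β μ 0 K (Λ₀ + t * (Λ₁ - Λ₀)))
                            (hubbardEffectiveActionCT L M β U μ 0 K (Λ₀ + t * (Λ₁ - Λ₀)))) 4
                          ![((p, σ), 1), ((p', σ), 0), (((y.2, y.1), 0), 0), (((x.2, x.1), 0), 1)] *
                        vertexFn L M β (gaussConv ℂ (softCovOf L M β μ K ψ + hubbardCovAboveCT L M β μ 0 K Λ₁ - hubbardCovAboveCT L M β μ 0 K (Λ₀ + t * (Λ₁ - Λ₀)))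
                            (hubbardEffectiveActionCT L M β U μ 0 K (Λ₀ + t * (Λ₁ - Λ₀)))) 4
                          ![((p, σ), 0), ((p', σ), 1), (((y.2.rev, Q - y.1), 1), 0), (((x.2.rev, Q - x.1), 1), 1)])
                  else 0) -
                (∑ p : FreqMomentum L M, ∑ p' : FreqMomentum L M,
                  if matsubaraInt M p'.1 + matsubaraInt M x.2 + matsubaraInt M y.2 + 1 = matsubaraInt M p.1 ∧
                      p'.2 = p.2 + Q - x.1 - y.1 then
                    ((((ψ p + (hubbardCutoffWeightCT L M β μ K Λ₁ p - hubbardCutoffWeightCT L M β μ K (Λ₀ + t * (Λ₁ - Λ₀)) p) : ℝ) : ℂ) *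
                          (((β * (L : ℝ) ^ 2 : ℝ) : ℂ) * propCT L M β μ K p)) *
                        (((deriv (fun Λ' : ℝ => hubbardCutoffWeightCT L M β μ K Λ' p') (Λ₀ + t * (Λ₁ - Λ₀)) : ℝ) : ℂ) *
                          (((β * (L : ℝ) ^ 2 : ℝ) : ℂ) * propCT L M β μ K p')) +
                      (((deriv (fun Λ' : ℝ => hubbardCutoffWeightCT L M β μ K Λ' p) (Λ₀ + t * (Λ₁ - Λ₀)) : ℝ) : ℂ) *
                          (((β * (L : ℝ) ^ 2 : ℝ) : ℂ) * propCT L M β μ K p)) *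
                        ((((ψ p' + (hubbardCutoffWeightCT L M β μ K Λ₁ p' - hubbardCutoffWeightCT L M β μ K (Λ₀ + t * (Λ₁ - Λ₀)) p') : ℝ) : ℂ) *
                          (((β * (L : ℝ) ^ 2 : ℝ) : ℂ) * propCT L M β μ K p')))) *
                      (vertexFn L M β (gaussConv ℂ (softCovOf L M β μ K ψ + hubbardCovAboveCT L M β μ 0 K Λ₁ - hubbardCovAboveCT L M β μ 0 K (Λ₀ + t * (Λ₁ - Λ₀)))
                            (hubbardEffectiveActionCT L M β U μ 0 K (Λ₀ + t * (Λ₁ - Λ₀)))) 4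
                          ![((p, 0), 1), ((p', 1), 0), (((y.2, y.1), 0), 0), (((x.2.rev, Q - x.1), 1), 1)] *
                        vertexFn L M β (gaussConv ℂ (softCovOf L M β μ K ψ + hubbardCovAboveCT L M β μ 0 K Λ₁ - hubbardCovAboveCT L M β μ 0 K (Λ₀ + t * (Λ₁ - Λ₀)))
                            (hubbardEffectiveActionCT L M β U μ 0 K (Λ₀ + t * (Λ₁ - Λ₀)))) 4
                          ![((p, 0), 0), ((p', 1), 1), (((y.2.rev, Q - y.1), 1), 0), (((x.2, x.1), 0), 1)])
                  else 0) -
                2 * ∑ p : FreqMomentum L M, ∑ σ : Fin 2,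
                  ((((deriv (fun Λ' : ℝ => hubbardCutoffWeightCT L M β μ K Λ' p) (Λ₀ + t * (Λ₁ - Λ₀)) : ℝ) : ℂ) *
                      (((β * (L : ℝ) ^ 2 : ℝ) : ℂ) * propCT L M β μ K p)) *
                    (((ψ p + (hubbardCutoffWeightCT L M β μ K Λ₁ p - hubbardCutoffWeightCT L M β μ K (Λ₀ + t * (Λ₁ - Λ₀)) p) : ℝ) : ℂ) *
                      (((β * (L : ℝ) ^ 2 : ℝ) : ℂ) * propCT L M β μ K p))) *
                  (vertexFn L M β (gaussConv ℂ (softCovOf L M β μ K ψ + hubbardCovAboveCT L M β μ 0 K Λ₁ - hubbardCovAboveCT L M β μ 0 K (Λ₀ + t * (Λ₁ - Λ₀)))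
                        (hubbardEffectiveActionCT L M β U μ 0 K (Λ₀ + t * (Λ₁ - Λ₀)))) 6
                      ![((p, σ), 0), ((p, σ), 1), (((y.2, y.1), 0), 0), (((y.2.rev, Q - y.1), 1), 0), (((x.2.rev, Q - x.1), 1), 1),
                        (((x.2, x.1), 0), 1)] *
                    selfEnergy L M β (gaussConv ℂ (softCovOf L M β μ K ψ + hubbardCovAboveCT L M β μ 0 K Λ₁ - hubbardCovAboveCT L M β μ 0 K (Λ₀ + t * (Λ₁ - Λ₀)))
                      (hubbardEffectiveActionCT L M β U μ 0 K (Λ₀ + t * (Λ₁ - Λ₀)))) p σ))) := by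
  subst hbdef hb'def
  refine ⟨fun t ht z => ?_, fun z => ?_, fun t ht x y => ?_⟩
  · -- (1) the rung is differentiable along the path
    have h := ((klmc_hasDerivAt_runningPair_path L M β μ K h10 h1 ψ ht (z.2, z.1) (z.2.rev, Q - z.1)).ofReal_comp).const_mul
      (-((((β * (L : ℝ) ^ 2 : ℝ) : ℂ))⁻¹ * propCT L M β μ K (z.2, z.1) * propCT L M β μ K (z.2.rev, Q - z.1)))
    simpa only [Function.comp_def] using h
  · -- (2) the rung derivative is continuous along the path
    have h := (klmc_continuousOn_runningPair_deriv_path L M β μ K h10 h1 ψ (z.2, z.1) (z.2.rev, Q - z.1))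
    exact continuousOn_const.mul (Complex.continuous_ofReal.comp_continuousOn h)
  · -- (3) the source is the non-ladder part
    have hne : Λ₀ + t * (Λ₁ - Λ₀) ≠ 0 := (h1.trans_le (klws_affine_mem_Icc h10 ht).1).ne'
    subst hΓdef hΓ'def
    rw [Matrix.add_apply, klli_mul_diag_mul_apply]
    simp only [Matrix.of_apply]
    rw [klws_gaussConv_derivPairing_eq_dblFold_cross ℂ _ _ (klws_derivHardCov_transpose L M β μ K _)
      (klws_effectiveActionR_mem_evenOdd_zero β U μ K _), Complex.real_smul,
      klmc_member_source_split β U μ K hβ ψ Λ₁ hne Q x y]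
    -- the Riccati term against `Γ·diag ḃ·Γ`
    have hrung : ∀ z : TorusSite 2 L × MatsubaraIdx M,
        vertexFn L M β (gaussConv ℂ (softCovOf L M β μ K ψ + hubbardCovAboveCT L M β μ 0 K Λ₁ - hubbardCovAboveCT L M β μ 0 K (Λ₀ + t * (Λ₁ - Λ₀))) (hubbardEffectiveActionCT L M β U μ 0 K (Λ₀ + t * (Λ₁ - Λ₀)))) 4
            ![(((z.2, z.1), 0), 0), (((z.2.rev, Q - z.1), 1), 0), (((x.2.rev, Q - x.1), 1), 1), (((x.2, x.1), 0), 1)] *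
          ((-((((β * (L : ℝ) ^ 2 : ℝ) : ℂ))⁻¹ * propCT L M β μ K (z.2, z.1) * propCT L M β μ K (z.2.rev, Q - z.1))) *
            ((((Λ₁ - Λ₀) * (-deriv (fun Λ' : ℝ => hubbardCutoffWeightCT L M β μ K Λ' (z.2, z.1)) (Λ₀ + t * (Λ₁ - Λ₀)) *
              (ψ (z.2.rev, Q - z.1) + (hubbardCutoffWeightCT L M β μ K Λ₁ (z.2.rev, Q - z.1) - hubbardCutoffWeightCT L M β μ K (Λ₀ + t * (Λ₁ - Λ₀)) (z.2.rev, Q - z.1))) -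
            (ψ (z.2, z.1) + (hubbardCutoffWeightCT L M β μ K Λ₁ (z.2, z.1) - hubbardCutoffWeightCT L M β μ K (Λ₀ + t * (Λ₁ - Λ₀)) (z.2, z.1))) *
              deriv (fun Λ' : ℝ => hubbardCutoffWeightCT L M β μ K Λ' (z.2.rev, Q - z.1)) (Λ₀ + t * (Λ₁ - Λ₀)))) : ℝ) : ℂ)) *
          vertexFn L M β (gaussConv ℂ (softCovOf L M β μ K ψ + hubbardCovAboveCT L M β μ 0 K Λ₁ - hubbardCovAboveCT L M β μ 0 K (Λ₀ + t * (Λ₁ - Λ₀))) (hubbardEffectiveActionCT L M β U μ 0 K (Λ₀ + t * (Λ₁ - Λ₀)))) 4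
            ![(((y.2, y.1), 0), 0), (((y.2.rev, Q - y.1), 1), 0), (((z.2.rev, Q - z.1), 1), 1), (((z.2, z.1), 0), 1)] =
        ((Λ₁ - Λ₀ : ℝ) : ℂ) * (((((β * (L : ℝ) ^ 2 : ℝ) : ℂ)) ^ 3)⁻¹ *
          ((((ψ (z.2, z.1) + (hubbardCutoffWeightCT L M β μ K Λ₁ (z.2, z.1) - hubbardCutoffWeightCT L M β μ K (Λ₀ + t * (Λ₁ - Λ₀)) (z.2, z.1)) : ℝ) : ℂ) * (((β * (L : ℝ) ^ 2 : ℝ) : ℂ) * propCT L M β μ K (z.2, z.1)) *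
              (((deriv (fun Λ' : ℝ => hubbardCutoffWeightCT L M β μ K Λ' (z.2.rev, Q - z.1)) (Λ₀ + t * (Λ₁ - Λ₀)) : ℝ) : ℂ) *
                (((β * (L : ℝ) ^ 2 : ℝ) : ℂ) * propCT L M β μ K (z.2.rev, Q - z.1))) +
            ((deriv (fun Λ' : ℝ => hubbardCutoffWeightCT L M β μ K Λ' (z.2, z.1)) (Λ₀ + t * (Λ₁ - Λ₀)) : ℝ) : ℂ) *
                (((β * (L : ℝ) ^ 2 : ℝ) : ℂ) * propCT L M β μ K (z.2, z.1)) *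
              (((ψ (z.2.rev, Q - z.1) + (hubbardCutoffWeightCT L M β μ K Λ₁ (z.2.rev, Q - z.1) - hubbardCutoffWeightCT L M β μ K (Λ₀ + t * (Λ₁ - Λ₀)) (z.2.rev, Q - z.1)) : ℝ) : ℂ) * (((β * (L : ℝ) ^ 2 : ℝ) : ℂ) * propCT L M β μ K (z.2.rev, Q - z.1)))) *
          (vertexFn L M β (gaussConv ℂ (softCovOf L M β μ K ψ + hubbardCovAboveCT L M β μ 0 K Λ₁ - hubbardCovAboveCT L M β μ 0 K (Λ₀ + t * (Λ₁ - Λ₀))) (hubbardEffectiveActionCT L M β U μ 0 K (Λ₀ + t * (Λ₁ - Λ₀)))) 4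
            ![(((z.2, z.1), 0), 0), (((z.2.rev, Q - z.1), 1), 0), (((x.2.rev, Q - x.1), 1), 1), (((x.2, x.1), 0), 1)] *
            vertexFn L M β (gaussConv ℂ (softCovOf L M β μ K ψ + hubbardCovAboveCT L M β μ 0 K Λ₁ - hubbardCovAboveCT L M β μ 0 K (Λ₀ + t * (Λ₁ - Λ₀))) (hubbardEffectiveActionCT L M β U μ 0 K (Λ₀ + t * (Λ₁ - Λ₀)))) 4
            ![(((y.2, y.1), 0), 0), (((y.2.rev, Q - y.1), 1), 0), (((z.2.rev, Q - z.1), 1), 1), (((z.2, z.1), 0), 1)]))) := by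
      intro z
      rw [klmc_rungRate_eq L β hβ (Λ₁ - Λ₀)]
      ring
    simp only [hrung, ← Finset.mul_sum]
    ring


end Model

end Summit.HubbardSuperconductivity.HubbardSuperconductivity.Theorems.KLRegimeWick

end
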